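import Literature.Probability.Distributions.GaussianWickTheorem

/-!
# Two Wick-ordered pairs of legs against a product: `E[:X_aX_a': :X_bX_b': ∏_s X]` — the engine of U5's connected diagrams

LEAD seat `ym-line-sfw-p2` (g78), cell ym-idea-1; U5 prep, helper-grade (planner ym-idea-2 g18, `U5-BLOCKERS.md` §2 lifts L2/L3:
«evaluate `f′(0) = κ₃,₀` and `f″(0) = κ₄,₀` EXACTLY by Wick (connected diagrams) instead of Cauchy–Schwarz»).

For legs `L : T → Ω → ℝ` under ANY measure `μ` satisfying the first-leg recursion (Gaussian integration by parts)
`∫ L_a ∏_{j∈s} L_{y j} dμ = Σ_{j∈s} S(a, y j) ∫ ∏_{i∈s∖j} L_{y i} dμ` and integrability of products of legs — the hypotheses of the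
tree's engine ✓`Literature.Probability.Distributions.GaussianWick.integral_wick2_mul_prod_of_ibp` — this file PROVES the
expectation of TWO Wick-ordered pairs `:L_aL_a': = L_aL_a' − S(a,a')`, `:L_bL_b': = L_bL_b' − S(b,b')` against an arbitrary finite
product of legs `∏_{j∈s} L_{y j}`:

  `∫ :L_aL_a': :L_bL_b': ∏_s dμ = (S_ab S_a'b' + S_ab' S_a'b)·∫∏_s`
     `+ Σ_{j∈s} Σ_{k∈s∖j} (S_ab S_a'j S_b'k + S_a'b S_aj S_b'k + S_ab' S_a'j S_bk + S_a'b' S_aj S_bk)·∫∏_{s∖jk}`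
     `+ Σ_{j,j',k,k' ∈ s distinct} S_aj S_a'j' S_bk S_b'k'·∫∏_{s∖jj'kk'}`

(`integral_wick2_wick2_mul_prod_of_ibp`; for centred Gaussian processes `integral_wick2_wick2_mul_prod`), i.e. NO self-line at
either pair: the two pairs are joined to each other by 2, 1 or 0 lines and every remaining leg is contracted into the product.
Subtracting `∫ :L_aL_a': :L_bL_b': dμ · ∫∏_s/μ(Ω)`-type products is then immediate: the CONNECTED part (at least one line from a
pair into the product) is the `1`-line and `0`-line sums (`integral_wick2_wick2_mul_prod_connected`).

Uses in the U5 chain (LINE-20, ⟨stmt-QuantumFields-24336⟩): with `:L_aL_a:`, `:L_bL_b:` the centred Gaussian parts `|ℓ_{p₀}^c|²`,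
`|ℓ_{p_T}^{c'}|²` of the two plaquette observables, `|s| = 2` is the quadratic-vertex triangle of ✓`…QuadFormCum3Wick` (w3 g41),
`|s| = 4` the quartic vertices of `κ₃,₀` (Q3′), and `|s| = 6` (two cubic `tripleForm` vertices, ✓T-S5.7a) the connected
four-point term of `κ₄,₀ = f″(0)` (`ConnectedFourPoint`, this seat's next file).

Mathlib + the tree's ✓`GaussianWickTheorem` only; no definitions; standard axioms.  HONEST LABEL: a combinatorial tool for the
RECORDED lifts L2/L3 of the NEXT rung U5 (⟨stmt-QuantumFields-24336⟩, UNSTAFFED); ⟨24004⟩ ⟨24336⟩ and this seat's own crux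
⟨stmt-QuantumFields-22884⟩ remain OPEN; route AllWindowsColdBox is DRAFT; no crux, rung or summit is proved; **the Yang–Mills mass
gap is NOT proved by this file; no summit is proved by a line.**
-/

set_option autoImplicit false

noncomputable section

open MeasureTheory ProbabilityTheory Finset
open Literature.Probability.Distributions.GaussianWick

namespace Summit.QuantumFields.YangMills.Theorems.AllWindowsColdBoxBoxHighLine

namespace WickTwoPairs

variable {T Ω : Type*} {mΩ : MeasurableSpace Ω}

/-! ## §1 The engine (any measure): two Wick-ordered pairs against a product -/

section Engine

universe v

variable {μ : Measure Ω} {L : T → Ω → ℝ} {S : T → T → ℝ}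

/-- one extra factor: `L_b ∏_{j∈s} L_{y j}` is integrable, from integrability of products over the enlarged family `(b, y)`. -/
theorem integrable_mul_prod_of_hint
    (hint : ∀ (κ : Type v) (s : Finset κ) (y : κ → T), Integrable (fun ω => ∏ j ∈ s, L (y j) ω) μ)
    (b : T) {κ : Type v} (s : Finset κ) (y : κ → T) :
    Integrable (fun ω => L b ω * ∏ j ∈ s, L (y j) ω) μ := by
  have h := hint (Option κ) (Finset.insertNone s) (fun o => o.elim b y)
  refine h.congr (ae_of_all _ fun ω => ?_)
  simp only [Finset.prod_insertNone, Option.elim_none, Option.elim_some]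

/-- two extra factors: `L_a (L_b ∏_{j∈s} L_{y j})` is integrable. -/
theorem integrable_mul_mul_prod_of_hint
    (hint : ∀ (κ : Type v) (s : Finset κ) (y : κ → T), Integrable (fun ω => ∏ j ∈ s, L (y j) ω) μ)
    (a b : T) {κ : Type v} (s : Finset κ) (y : κ → T) :
    Integrable (fun ω => L a ω * (L b ω * ∏ j ∈ s, L (y j) ω)) μ := by
  have h := integrable_mul_prod_of_hint hint a (Finset.insertNone s) (fun o => o.elim b y)
  refine h.congr (ae_of_all _ fun ω => ?_)
  simp only [Finset.prod_insertNone, Option.elim_none, Option.elim_some]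

/-- four extra factors: `L_a (L_b (L_c (L_d ∏_{j∈s} L_{y j})))` is integrable. -/
theorem integrable_mul_mul_mul_mul_prod_of_hint
    (hint : ∀ (κ : Type v) (s : Finset κ) (y : κ → T), Integrable (fun ω => ∏ j ∈ s, L (y j) ω) μ)
    (a b c d : T) {κ : Type v} (s : Finset κ) (y : κ → T) :
    Integrable (fun ω => L a ω * (L b ω * (L c ω * (L d ω * ∏ j ∈ s, L (y j) ω)))) μ := by
  have h := integrable_mul_mul_prod_of_hint hint a b (Finset.insertNone (Finset.insertNone s))
    (fun o => o.elim c fun o' => o'.elim d y)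
  refine h.congr (ae_of_all _ fun ω => ?_)
  simp only [Finset.prod_insertNone, Option.elim_none, Option.elim_some]

/-- ★★ **TWO WICK-ORDERED PAIRS AGAINST A PRODUCT** (the combinatorial engine, any measure): under the first-leg recursion and
integrability of products of legs,
`∫ :L_aL_a': :L_bL_b': ∏_{j∈s} L_{y j} dμ = (S_ab S_a'b' + S_ab' S_a'b) ∫∏_s + Σ_{j∈s}Σ_{k∈s∖j} (S_ab S_a'j S_b'k + S_a'b S_aj S_b'k
+ S_ab' S_a'j S_bk + S_a'b' S_aj S_bk) ∫∏_{s∖jk} + Σ_{j,j',k,k'∈s distinct} S_aj S_a'j' S_bk S_b'k' ∫∏_{s∖jj'kk'}` — neither pair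
carries a self-line; the pairs are joined by two, one or zero lines and the other legs go into the product
(Glimm–Jaffe Cor. 8.3.2 for two two-leg Wick vertices). -/
theorem integral_wick2_wick2_mul_prod_of_ibp
    (hibp : ∀ (a : T) (κ : Type v) [DecidableEq κ] (s : Finset κ) (y : κ → T),
      ∫ ω, L a ω * ∏ j ∈ s, L (y j) ω ∂μ = ∑ j ∈ s, S a (y j) * ∫ ω, ∏ i ∈ s.erase j, L (y i) ω ∂μ)
    (hint : ∀ (κ : Type v) (s : Finset κ) (y : κ → T), Integrable (fun ω => ∏ j ∈ s, L (y j) ω) μ)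
    (a a' b b' : T) {κ : Type v} [DecidableEq κ] (s : Finset κ) (y : κ → T) :
    ∫ ω, (L a ω * L a' ω - S a a') * (L b ω * L b' ω - S b b') * ∏ j ∈ s, L (y j) ω ∂μ =
      (S a b * S a' b' + S a b' * S a' b) * ∫ ω, ∏ j ∈ s, L (y j) ω ∂μ
      + ∑ j ∈ s, ∑ k ∈ s.erase j,
          (S a b * S a' (y j) * S b' (y k) + S a' b * S a (y j) * S b' (y k)
            + S a b' * S a' (y j) * S b (y k) + S a' b' * S a (y j) * S b (y k)) *
          ∫ ω, ∏ i ∈ (s.erase j).erase k, L (y i) ω ∂μ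
      + ∑ j ∈ s, ∑ j' ∈ s.erase j, ∑ k ∈ (s.erase j).erase j', ∑ k' ∈ ((s.erase j).erase j').erase k,
          S a (y j) * S a' (y j') * S b (y k) * S b' (y k') *
            ∫ ω, ∏ i ∈ (((s.erase j).erase j').erase k).erase k', L (y i) ω ∂μ := by
  classical
  -- the building blocks: `hD` = the recursion, `hL1` = one more factor, `hL2` = two more, `hL3` = three more
  have hD : ∀ (x : T) (t : Finset κ), ∫ ω, L x ω * ∏ j ∈ t, L (y j) ω ∂μ =
      ∑ i ∈ t, S x (y i) * ∫ ω, ∏ j ∈ t.erase i, L (y j) ω ∂μ := fun x t => hibp x κ t y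
  have hL1 : ∀ (x x' : T) (t : Finset κ), ∫ ω, L x ω * (L x' ω * ∏ j ∈ t, L (y j) ω) ∂μ =
      S x x' * ∫ ω, ∏ j ∈ t, L (y j) ω ∂μ + ∑ i ∈ t, S x (y i) * ∫ ω, L x' ω * ∏ j ∈ t.erase i, L (y j) ω ∂μ :=
    fun x x' t => integral_mul_mul_prod_of_ibp (S := S) hibp x x' t y
  have hL2 : ∀ t : Finset κ, ∫ ω, L a' ω * (L b ω * (L b' ω * ∏ j ∈ t, L (y j) ω)) ∂μ =
      S a' b * ∫ ω, L b' ω * ∏ j ∈ t, L (y j) ω ∂μ + S a' b' * ∫ ω, L b ω * ∏ j ∈ t, L (y j) ω ∂μ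
        + ∑ i ∈ t, S a' (y i) * ∫ ω, L b ω * (L b' ω * ∏ j ∈ t.erase i, L (y j) ω) ∂μ :=
    fun t => integral_mul_mul_mul_prod_of_ibp (S := S) hibp a' b b' t y
  have hL3 := integral_mul_mul_mul_mul_prod_of_ibp (S := S) hibp a a' b b' s y
  -- Step 1 (linearity): `∫ :aa'::bb': ∏ = E[aa'bb'∏] − S_aa' E[bb'∏] − S_bb' E[aa'∏] + S_aa' S_bb' E[∏]`
  have I0 : Integrable (fun ω => ∏ j ∈ s, L (y j) ω) μ := hint κ s y
  have I2 : ∀ x x' : T, Integrable (fun ω => L x ω * (L x' ω * ∏ j ∈ s, L (y j) ω)) μ :=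
    fun x x' => integrable_mul_mul_prod_of_hint hint x x' s y
  have I4 : Integrable (fun ω => L a ω * (L a' ω * (L b ω * (L b' ω * ∏ j ∈ s, L (y j) ω)))) μ :=
    integrable_mul_mul_mul_mul_prod_of_hint hint a a' b b' s y
  have e1 : (fun ω => (L a ω * L a' ω - S a a') * (L b ω * L b' ω - S b b') * ∏ j ∈ s, L (y j) ω) =
      fun ω => L a ω * (L a' ω * (L b ω * (L b' ω * ∏ j ∈ s, L (y j) ω)))
        - S a a' * (L b ω * (L b' ω * ∏ j ∈ s, L (y j) ω)) - S b b' * (L a ω * (L a' ω * ∏ j ∈ s, L (y j) ω))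
        + (S a a' * S b b') * ∏ j ∈ s, L (y j) ω := by
    funext ω; ring
  have J1 : Integrable (fun ω => L a ω * (L a' ω * (L b ω * (L b' ω * ∏ j ∈ s, L (y j) ω)))
      - S a a' * (L b ω * (L b' ω * ∏ j ∈ s, L (y j) ω))) μ := I4.sub ((I2 b b').const_mul _)
  have J2 : Integrable (fun ω => L a ω * (L a' ω * (L b ω * (L b' ω * ∏ j ∈ s, L (y j) ω)))
      - S a a' * (L b ω * (L b' ω * ∏ j ∈ s, L (y j) ω)) - S b b' * (L a ω * (L a' ω * ∏ j ∈ s, L (y j) ω))) μ :=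
    J1.sub ((I2 a a').const_mul _)
  rw [e1, integral_add J2 (I0.const_mul _), integral_sub J1 ((I2 a a').const_mul _),
    integral_sub I4 ((I2 b b').const_mul _)]
  simp only [integral_const_mul]
  -- Step 2 (the recursions)
  -- `E[x (x' ∏_t)]` fully expanded (two legs into the product)
  have kxx : ∀ (x x' : T) (t : Finset κ), ∫ ω, L x ω * (L x' ω * ∏ j ∈ t, L (y j) ω) ∂μ =
      S x x' * ∫ ω, ∏ j ∈ t, L (y j) ω ∂μ
        + ∑ i ∈ t, ∑ i' ∈ t.erase i, S x (y i) * S x' (y i') * ∫ ω, ∏ j ∈ (t.erase i).erase i', L (y j) ω ∂μ := by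
    intro x x' t
    rw [hL1]
    congr 1
    refine Finset.sum_congr rfl fun i _ => ?_
    rw [hD, Finset.mul_sum]
    exact Finset.sum_congr rfl fun i' _ => by ring
  -- `E[a' (b (b' ∏_t))]` fully expanded
  have hB3 : ∀ t : Finset κ, ∫ ω, L a' ω * (L b ω * (L b' ω * ∏ j ∈ t, L (y j) ω)) ∂μ =
      S a' b * ∑ k ∈ t, S b' (y k) * ∫ ω, ∏ j ∈ t.erase k, L (y j) ω ∂μ
        + S a' b' * ∑ k ∈ t, S b (y k) * ∫ ω, ∏ j ∈ t.erase k, L (y j) ω ∂μ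
        + S b b' * ∑ i' ∈ t, S a' (y i') * ∫ ω, ∏ j ∈ t.erase i', L (y j) ω ∂μ
        + ∑ i' ∈ t, ∑ k ∈ t.erase i', ∑ k' ∈ (t.erase i').erase k, S a' (y i') * S b (y k) * S b' (y k') *
            ∫ ω, ∏ j ∈ ((t.erase i').erase k).erase k', L (y j) ω ∂μ := by
    intro t
    rw [hL2 t, hD, hD]
    have h3 : ∑ i ∈ t, S a' (y i) * ∫ ω, L b ω * (L b' ω * ∏ j ∈ t.erase i, L (y j) ω) ∂μ =
        S b b' * ∑ i' ∈ t, S a' (y i') * ∫ ω, ∏ j ∈ t.erase i', L (y j) ω ∂μ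
        + ∑ i' ∈ t, ∑ k ∈ t.erase i', ∑ k' ∈ (t.erase i').erase k, S a' (y i') * S b (y k) * S b' (y k') *
            ∫ ω, ∏ j ∈ ((t.erase i').erase k).erase k', L (y j) ω ∂μ := by
      rw [Finset.mul_sum, ← Finset.sum_add_distrib]
      refine Finset.sum_congr rfl fun i' _ => ?_
      rw [kxx, mul_add, Finset.mul_sum]
      congr 1
      · ring
      · refine Finset.sum_congr rfl fun k _ => ?_
        rw [Finset.mul_sum]
        exact Finset.sum_congr rfl fun k' _ => by ring
    rw [h3]
    ring
  -- the last sum of `hL3`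
  have k1 : ∑ i ∈ s, S a (y i) * ∫ ω, L a' ω * (L b ω * (L b' ω * ∏ j ∈ s.erase i, L (y j) ω)) ∂μ =
      ∑ i ∈ s, ∑ k ∈ s.erase i, (S a' b * S a (y i) * S b' (y k) + S a' b' * S a (y i) * S b (y k)) *
          ∫ ω, ∏ j ∈ (s.erase i).erase k, L (y j) ω ∂μ
        + S b b' * ∑ i ∈ s, ∑ i' ∈ s.erase i, S a (y i) * S a' (y i') * ∫ ω, ∏ j ∈ (s.erase i).erase i', L (y j) ω ∂μ
        + ∑ i ∈ s, ∑ i' ∈ s.erase i, ∑ k ∈ (s.erase i).erase i', ∑ k' ∈ ((s.erase i).erase i').erase k,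
            S a (y i) * S a' (y i') * S b (y k) * S b' (y k') *
              ∫ ω, ∏ j ∈ (((s.erase i).erase i').erase k).erase k', L (y j) ω ∂μ := by
    rw [Finset.mul_sum, ← Finset.sum_add_distrib, ← Finset.sum_add_distrib]
    refine Finset.sum_congr rfl fun i _ => ?_
    rw [hB3]
    have e4 : S a (y i) * ∑ i' ∈ s.erase i, ∑ k ∈ (s.erase i).erase i', ∑ k' ∈ ((s.erase i).erase i').erase k,
        S a' (y i') * S b (y k) * S b' (y k') * ∫ ω, ∏ j ∈ (((s.erase i).erase i').erase k).erase k', L (y j) ω ∂μ =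
        ∑ i' ∈ s.erase i, ∑ k ∈ (s.erase i).erase i', ∑ k' ∈ ((s.erase i).erase i').erase k,
          S a (y i) * S a' (y i') * S b (y k) * S b' (y k') *
            ∫ ω, ∏ j ∈ (((s.erase i).erase i').erase k).erase k', L (y j) ω ∂μ := by
      rw [Finset.mul_sum]
      refine Finset.sum_congr rfl fun i' _ => ?_
      rw [Finset.mul_sum]
      refine Finset.sum_congr rfl fun k _ => ?_
      rw [Finset.mul_sum]
      exact Finset.sum_congr rfl fun k' _ => by ring
    have e3 : S a (y i) * (S b b' * ∑ i' ∈ s.erase i, S a' (y i') * ∫ ω, ∏ j ∈ (s.erase i).erase i', L (y j) ω ∂μ) =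
        S b b' * ∑ i' ∈ s.erase i, S a (y i) * S a' (y i') * ∫ ω, ∏ j ∈ (s.erase i).erase i', L (y j) ω ∂μ := by
      rw [Finset.mul_sum, Finset.mul_sum, Finset.mul_sum]
      exact Finset.sum_congr rfl fun i' _ => by ring
    have e2 : S a (y i) * (S a' b * ∑ k ∈ s.erase i, S b' (y k) * ∫ ω, ∏ j ∈ (s.erase i).erase k, L (y j) ω ∂μ)
        + S a (y i) * (S a' b' * ∑ k ∈ s.erase i, S b (y k) * ∫ ω, ∏ j ∈ (s.erase i).erase k, L (y j) ω ∂μ) =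
        ∑ k ∈ s.erase i, (S a' b * S a (y i) * S b' (y k) + S a' b' * S a (y i) * S b (y k)) *
          ∫ ω, ∏ j ∈ (s.erase i).erase k, L (y j) ω ∂μ := by
      rw [Finset.mul_sum, Finset.mul_sum, Finset.mul_sum, Finset.mul_sum, ← Finset.sum_add_distrib]
      exact Finset.sum_congr rfl fun k _ => by ring
    rw [mul_add, mul_add, mul_add, e4, e3, e2]
  rw [hL3, k1, kxx a' b' s, kxx a' b s, kxx a a' s]
  -- Step 3: collect
  have e5 : ∑ j ∈ s, ∑ k ∈ s.erase j,
        (S a b * S a' (y j) * S b' (y k) + S a' b * S a (y j) * S b' (y k)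
          + S a b' * S a' (y j) * S b (y k) + S a' b' * S a (y j) * S b (y k)) *
        ∫ ω, ∏ i ∈ (s.erase j).erase k, L (y i) ω ∂μ =
      S a b * ∑ j ∈ s, ∑ k ∈ s.erase j, S a' (y j) * S b' (y k) * ∫ ω, ∏ i ∈ (s.erase j).erase k, L (y i) ω ∂μ
      + S a b' * ∑ j ∈ s, ∑ k ∈ s.erase j, S a' (y j) * S b (y k) * ∫ ω, ∏ i ∈ (s.erase j).erase k, L (y i) ω ∂μ
      + ∑ j ∈ s, ∑ k ∈ s.erase j, (S a' b * S a (y j) * S b' (y k) + S a' b' * S a (y j) * S b (y k)) *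
          ∫ ω, ∏ i ∈ (s.erase j).erase k, L (y i) ω ∂μ := by
    rw [Finset.mul_sum, Finset.mul_sum, ← Finset.sum_add_distrib, ← Finset.sum_add_distrib]
    refine Finset.sum_congr rfl fun j _ => ?_
    rw [Finset.mul_sum, Finset.mul_sum, ← Finset.sum_add_distrib, ← Finset.sum_add_distrib]
    exact Finset.sum_congr rfl fun k _ => by ring
  rw [e5]
  ring

/-- `∫ :L_aL_a': :L_bL_b': dμ = (S_ab S_a'b' + S_ab' S_a'b)·μ(Ω)` — with no other factor only the two lines joining the pairs
remain (`s = ∅`; here `μ(Ω)` appears as `∫ 1 dμ = ∫ ∏_∅`). -/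
theorem integral_wick2_wick2_of_ibp
    (hibp : ∀ (a : T) (κ : Type v) [DecidableEq κ] (s : Finset κ) (y : κ → T),
      ∫ ω, L a ω * ∏ j ∈ s, L (y j) ω ∂μ = ∑ j ∈ s, S a (y j) * ∫ ω, ∏ i ∈ s.erase j, L (y i) ω ∂μ)
    (hint : ∀ (κ : Type v) (s : Finset κ) (y : κ → T), Integrable (fun ω => ∏ j ∈ s, L (y j) ω) μ)
    (a a' b b' : T) :
    ∫ ω, (L a ω * L a' ω - S a a') * (L b ω * L b' ω - S b b') ∂μ =
      (S a b * S a' b' + S a b' * S a' b) * μ.real Set.univ := by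
  have h := integral_wick2_wick2_mul_prod_of_ibp hibp hint a a' b b' (κ := PUnit.{v + 1}) ∅ (fun _ => a)
  simpa using h

end Engine

/-! ## §2 Centred Gaussian processes -/

section Gaussian

universe v

variable {P : Measure Ω} {X : T → Ω → ℝ}

/-- ★★ **Two Wick-ordered pairs of a centred Gaussian process against a product**: with `S(s,t) = E[X_sX_t]`,
`E[:X_aX_a': :X_bX_b': ∏_{j∈s} X_{y j}] = (S_ab S_a'b' + S_ab' S_a'b) E[∏_s] + Σ_{j∈s}Σ_{k∈s∖j} (S_ab S_a'j S_b'k + S_a'b S_aj S_b'k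
+ S_ab' S_a'j S_bk + S_a'b' S_aj S_bk) E[∏_{s∖jk}] + Σ_{j,j',k,k'∈s distinct} S_aj S_a'j' S_bk S_b'k' E[∏_{s∖jj'kk'}]`
(§1 fed with the tree's Gaussian integration by parts ✓`integral_mul_prod_eq_sum`). -/
theorem integral_wick2_wick2_mul_prod (hX : IsGaussianProcess X P) (h0 : ∀ t, ∫ ω, X t ω ∂P = 0) (a a' b b' : T)
    {κ : Type v} [DecidableEq κ] (s : Finset κ) (y : κ → T) :
    ∫ ω, (X a ω * X a' ω - ∫ ω', X a ω' * X a' ω' ∂P) * (X b ω * X b' ω - ∫ ω', X b ω' * X b' ω' ∂P) *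
        ∏ j ∈ s, X (y j) ω ∂P =
      ((∫ ω, X a ω * X b ω ∂P) * (∫ ω, X a' ω * X b' ω ∂P) + (∫ ω, X a ω * X b' ω ∂P) * (∫ ω, X a' ω * X b ω ∂P)) *
          ∫ ω, ∏ j ∈ s, X (y j) ω ∂P
      + ∑ j ∈ s, ∑ k ∈ s.erase j,
          ((∫ ω, X a ω * X b ω ∂P) * (∫ ω, X a' ω * X (y j) ω ∂P) * (∫ ω, X b' ω * X (y k) ω ∂P)
            + (∫ ω, X a' ω * X b ω ∂P) * (∫ ω, X a ω * X (y j) ω ∂P) * (∫ ω, X b' ω * X (y k) ω ∂P)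
            + (∫ ω, X a ω * X b' ω ∂P) * (∫ ω, X a' ω * X (y j) ω ∂P) * (∫ ω, X b ω * X (y k) ω ∂P)
            + (∫ ω, X a' ω * X b' ω ∂P) * (∫ ω, X a ω * X (y j) ω ∂P) * (∫ ω, X b ω * X (y k) ω ∂P)) *
          ∫ ω, ∏ i ∈ (s.erase j).erase k, X (y i) ω ∂P
      + ∑ j ∈ s, ∑ j' ∈ s.erase j, ∑ k ∈ (s.erase j).erase j', ∑ k' ∈ ((s.erase j).erase j').erase k,
          (∫ ω, X a ω * X (y j) ω ∂P) * (∫ ω, X a' ω * X (y j') ω ∂P) * (∫ ω, X b ω * X (y k) ω ∂P) *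
            (∫ ω, X b' ω * X (y k') ω ∂P) *
            ∫ ω, ∏ i ∈ (((s.erase j).erase j').erase k).erase k', X (y i) ω ∂P :=
  integral_wick2_wick2_mul_prod_of_ibp (S := fun s t => ∫ ω, X s ω * X t ω ∂P)
    (fun a'' _ _ s' y' => integral_mul_prod_eq_sum hX h0 a'' s' y') (fun _ s' y' => integrable_prod hX s' y') a a' b b' s y

/-- `E[:X_aX_a': :X_bX_b':] = S_ab S_a'b' + S_ab' S_a'b` for a centred Gaussian process (the two ways of joining the pairs). -/
theorem integral_wick2_wick2 (hX : IsGaussianProcess X P) (h0 : ∀ t, ∫ ω, X t ω ∂P = 0) (a a' b b' : T) :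
    ∫ ω, (X a ω * X a' ω - ∫ ω', X a ω' * X a' ω' ∂P) * (X b ω * X b' ω - ∫ ω', X b ω' * X b' ω' ∂P) ∂P =
      (∫ ω, X a ω * X b ω ∂P) * (∫ ω, X a' ω * X b' ω ∂P) + (∫ ω, X a ω * X b' ω ∂P) * (∫ ω, X a' ω * X b ω ∂P) := by
  have := hX.isProbabilityMeasure
  have h := integral_wick2_wick2_mul_prod hX h0 a a' b b' (κ := Unit) ∅ (fun _ => a)
  simpa using h

/-- ★ **The CONNECTED part** — every pairing with at least one line from a pair into the product:
`E[:X_aX_a': :X_bX_b': ∏_s] − E[:X_aX_a': :X_bX_b':]·E[∏_s] = (one-line sum) + (no-line sum)` — the input of U5's exact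
`κ₃,₀` (quartic vertices, `|s| = 4`) and `κ₄,₀` (two cubic vertices, `|s| = 6`). -/
theorem integral_wick2_wick2_mul_prod_connected (hX : IsGaussianProcess X P) (h0 : ∀ t, ∫ ω, X t ω ∂P = 0)
    (a a' b b' : T) {κ : Type v} [DecidableEq κ] (s : Finset κ) (y : κ → T) :
    ∫ ω, (X a ω * X a' ω - ∫ ω', X a ω' * X a' ω' ∂P) * (X b ω * X b' ω - ∫ ω', X b ω' * X b' ω' ∂P) *
        ∏ j ∈ s, X (y j) ω ∂P
      - (∫ ω, (X a ω * X a' ω - ∫ ω', X a ω' * X a' ω' ∂P) * (X b ω * X b' ω - ∫ ω', X b ω' * X b' ω' ∂P) ∂P) *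
          ∫ ω, ∏ j ∈ s, X (y j) ω ∂P =
      ∑ j ∈ s, ∑ k ∈ s.erase j,
          ((∫ ω, X a ω * X b ω ∂P) * (∫ ω, X a' ω * X (y j) ω ∂P) * (∫ ω, X b' ω * X (y k) ω ∂P)
            + (∫ ω, X a' ω * X b ω ∂P) * (∫ ω, X a ω * X (y j) ω ∂P) * (∫ ω, X b' ω * X (y k) ω ∂P)
            + (∫ ω, X a ω * X b' ω ∂P) * (∫ ω, X a' ω * X (y j) ω ∂P) * (∫ ω, X b ω * X (y k) ω ∂P)
            + (∫ ω, X a' ω * X b' ω ∂P) * (∫ ω, X a ω * X (y j) ω ∂P) * (∫ ω, X b ω * X (y k) ω ∂P)) *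
          ∫ ω, ∏ i ∈ (s.erase j).erase k, X (y i) ω ∂P
      + ∑ j ∈ s, ∑ j' ∈ s.erase j, ∑ k ∈ (s.erase j).erase j', ∑ k' ∈ ((s.erase j).erase j').erase k,
          (∫ ω, X a ω * X (y j) ω ∂P) * (∫ ω, X a' ω * X (y j') ω ∂P) * (∫ ω, X b ω * X (y k) ω ∂P) *
            (∫ ω, X b' ω * X (y k') ω ∂P) *
            ∫ ω, ∏ i ∈ (((s.erase j).erase j').erase k).erase k', X (y i) ω ∂P := by
  rw [integral_wick2_wick2_mul_prod hX h0 a a' b b' s y, integral_wick2_wick2 hX h0 a a' b b']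
  ring

end Gaussian

end WickTwoPairs

end Summit.QuantumFields.YangMills.Theorems.AllWindowsColdBoxBoxHighLine

end
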